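import Summits.HodgeConjecture.HodgeConjecture.Theorems.HodgeFermatVarieties.Negative.LevelThirtyThreeParity

/-!
# `HodgeFermatVarieties` (stmt-HodgeConjecture-1334): the printed claim calculus of level `33` alone cannot reach da Silva's class (part 2 of 2)

Negative lemma of the standing disprover of the crux
`Summit.HodgeConjecture.HodgeConjecture.Theses.PadicSemiregularLift.HodgeFermatVarieties` (the Hodge
conjecture for all complex Fermat hypersurfaces `Xⁿₘ`), sorry-free, axioms `{propext, Classical.choice,
Quot.sound}` (no `native_decide`; the two enumerations are kernel `decide`).

The lines on this crux (cards `sign-class-saturation`, `cancel-by-any-claim-lattice`, `primitive-gap-descent`)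
derive Aoki's claim(`s`) — the eigenline `V(α)`, `α ∼ s`, consists of classes of algebraic cycles — from the
PRINTED SUPPLY of the level `m` of `s` by the calculus of the tree's named facts: Shioda's pairs
(`Shioda_claim_paired`), Lefschetz `(1,1)` on the Fermat surface (every Hodge 4-multiset), Shioda's
semi-decomposable sextuples (type II), Aoki 1987 Thm. 1-4 (i) (juxtaposition) and (ii) (pair cancellation),
the type-I map, Aoki 1987 Thm. 2-1 (standard elements `σ_{p,a}`), and the general-cancellation lever GC.
At level `33` this calculus has a CLOSED FAMILY THAT MISSES da Silva's Hodge character `(1,4,16,25,31,22)`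
of `X⁴₃₃` (da Silva 2021, Prop. 3.4 of the version of record: "`(P₃₃)` is false" is its one-step shadow):

* `C s :=` "an even number of entries of `s` is divisible by `11`" (the Yamamoto sign character of level
  `33` in the coordinates of this file; cf. Aoki's description of `S₃₃` by the parity of unit entries);
* `rel33`: for EVERY Hodge multiset `s` of `ℤ/33`, `#(entries in U2) − #(entries in U1) = 5·#11(s) − 5·#22(s)`
  (`U1`, `U2` the units `≡ 1, 2 (mod 3)`) — the Hodge condition summed over the ten units `≡ 1 (mod 3)`;
  hence every Hodge 4-multiset has as many `11`'s as `22`'s (`even_countP_of_card_four`, no enumeration), and an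
  odd Hodge sextuple is five units in one class mod `3` plus one multiple of `11` (`shape_of_card_six`);
* `even_countP_of_isSemiDecomposable`: no such sextuple is semi-decomposable (part 1's `enum22`, `enum11`);
* `isShiodaClosed_parity33` and the independence theorems `exists_closed_family_not_daSilva33` /
  `not_forall_closed_family_daSilva33` (this file); `rel33`, `even_countP_of_card_four`, `shape_of_card_six`
  are in part 1 (`LevelThirtyThreeParity`).

CONSEQUENCE (for provers and planners): any derivation of claim(da Silva) — hence of HC(`X⁴₃₃`) — from the
printed supply must change level (the crux team's level-`66` certificate does exactly that) or use a new
cycle. Companion computations (disprover's folder `calc/deathtable.py`, exact GF(2) certificates): the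
analogous functionals exist for `gap₃₅ = (1,2,16,17,21,22,30,31)` at EVERY level `35k ≤ 490`, for
`gap₄₄ = (1,4,5,13,33,37,41,42)` at every `44k ≤ 484`, for `(1,24,62,71,81,91)` at `110k ≤ 440`, and for
da Silva's class at the odd multiples `33k ≤ 495` (it dies at the even ones).

Refuter refuter-cdisprove-stmt-HodgeConjecture-1334-g2-0, 2026-08-16 (full analysis:
`Cruxes/HodgeFermatVarieties/Disproof.lean` §7).

## References

* [Aoki1987] N. Aoki, Some new algebraic cycles on Fermat varieties, J. Math. Soc. Japan 39 (1987) 385–396,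
  Thm. 1-1, Thm. 1-4 (i),(ii), Thm. 2-1 (the calculus modelled; through the tree's `FermatInductiveClaims`).
* [daSilva2021HodgeFermat] G. da Silva Jr., Notes on the Hodge Conjecture for Fermat Varieties, Experimental
  Results 2 (2021) e22, Prop. 3.4 (version of record) = arXiv:2101.04739 Prop. 3.6 (`(P₃₃)` is false).
* [Shioda1979PJA] T. Shioda, Proc. Japan Acad. 55A (1979) 111–114, §1 (the semigroup `Mₘ`, `(Pₘ)`).
-/

namespace Summit.HodgeConjecture.HodgeConjecture.Theorems.HodgeFermatVarietiesNegative

open Finset Multiset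
open Literature.AlgebraicGeometry.HodgeTheory Literature.AlgebraicGeometry.HodgeTheory.FermatCharacter


/-- Core of the `semi` closure, case `22 ∈` the first triple. [folklore] -/
theorem semi_core22 {t u : Multiset (ZMod 33)} (ht : card t = 3) (hu : card u = 3)
    (ht0 : t.sum = 0) (hu0 : u.sum = 0) (hmem : ∀ a ∈ t + u, a ∈ ({1, 4, 7, 10, 13, 16, 19, 25, 28,
          31} : Finset (ZMod 33)) ∨ a = 22)
    (hc : count 22 (t + u) = 1) (h22 : (22 : ZMod 33) ∈ t) : ¬ IsHodgeMultiset (t + u) := by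
  obtain ⟨t', rfl⟩ := exists_cons_of_mem h22
  have ht' : card t' = 2 := by rw [Multiset.card_cons] at ht; omega
  obtain ⟨y, z, rfl⟩ := Multiset.card_eq_two.1 ht'
  obtain ⟨x', y', z', rfl⟩ := Multiset.card_eq_three.1 hu
  have hz : z = -(22 + y) := by
    have : (22 : ZMod 33) + (y + z) = 0 := by simpa [add_assoc] using ht0
    linear_combination this
  have hz' : z' = -(x' + y') := by
    have : x' + (y' + z') = 0 := by simpa [add_assoc] using hu0
    linear_combination this
  have hrest : (22 : ZMod 33) ∉ (({y, z} : Multiset (ZMod 33)) + {x', y', z'}) := by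
    rw [Multiset.cons_add, count_cons_self] at hc
    exact count_eq_zero.1 (by omega)
  have hmem' : ∀ a ∈ (({y, z} : Multiset (ZMod 33)) + {x', y', z'}), a ∈ ({1, 4, 7, 10, 13, 16, 19, 25, 28,
        31} : Finset (ZMod 33)) := by
    intro a ha
    rcases hmem a (by rw [Multiset.cons_add]; exact mem_cons_of_mem ha) with h | h
    · exact h
    · exact absurd (h ▸ ha) hrest
  have hy : y ∈ ({1, 4, 7, 10, 13, 16, 19, 25, 28, 31} : Finset (ZMod 33)) := hmem' y (by simp)
  have hx' : x' ∈ ({1, 4, 7, 10, 13, 16, 19, 25, 28, 31} : Finset (ZMod 33)) := hmem' x' (by simp)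
  have hy' : y' ∈ ({1, 4, 7, 10, 13, 16, 19, 25, 28, 31} : Finset (ZMod 33)) := hmem' y' (by simp)
  obtain ⟨t₀, ht₀, hne⟩ := enum22 y hy x' hx' y' hy'
  subst hz hz'
  have hshape : ((22 : ZMod 33) ::ₘ ({y, -(22 + y)} : Multiset (ZMod 33))) + {x', y', -(x' + y')} =
      (22 : ZMod 33) ::ₘ y ::ₘ (-(22 + y)) ::ₘ x' ::ₘ y' ::ₘ {-(x' + y')} := by
    simp only [insert_eq_cons, cons_add, singleton_add]
  rw [hshape]
  exact not_isHodgeMultiset_of_witness ht₀ hne (by simp)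

/-- Core of the `semi` closure, case `11 ∈` the first triple. [folklore] -/
theorem semi_core11 {t u : Multiset (ZMod 33)} (ht : card t = 3) (hu : card u = 3)
    (ht0 : t.sum = 0) (hu0 : u.sum = 0) (hmem : ∀ a ∈ t + u, a ∈ ({2, 5, 8, 14, 17, 20, 23, 26, 29,
          32} : Finset (ZMod 33)) ∨ a = 11)
    (hc : count 11 (t + u) = 1) (h11 : (11 : ZMod 33) ∈ t) : ¬ IsHodgeMultiset (t + u) := by
  obtain ⟨t', rfl⟩ := exists_cons_of_mem h11
  have ht' : card t' = 2 := by rw [Multiset.card_cons] at ht; omega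
  obtain ⟨y, z, rfl⟩ := Multiset.card_eq_two.1 ht'
  obtain ⟨x', y', z', rfl⟩ := Multiset.card_eq_three.1 hu
  have hz : z = -(11 + y) := by
    have : (11 : ZMod 33) + (y + z) = 0 := by simpa [add_assoc] using ht0
    linear_combination this
  have hz' : z' = -(x' + y') := by
    have : x' + (y' + z') = 0 := by simpa [add_assoc] using hu0
    linear_combination this
  have hrest : (11 : ZMod 33) ∉ (({y, z} : Multiset (ZMod 33)) + {x', y', z'}) := by
    rw [Multiset.cons_add, count_cons_self] at hc
    exact count_eq_zero.1 (by omega)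
  have hmem' : ∀ a ∈ (({y, z} : Multiset (ZMod 33)) + {x', y', z'}), a ∈ ({2, 5, 8, 14, 17, 20, 23, 26, 29,
        32} : Finset (ZMod 33)) := by
    intro a ha
    rcases hmem a (by rw [Multiset.cons_add]; exact mem_cons_of_mem ha) with h | h
    · exact h
    · exact absurd (h ▸ ha) hrest
  have hy : y ∈ ({2, 5, 8, 14, 17, 20, 23, 26, 29, 32} : Finset (ZMod 33)) := hmem' y (by simp)
  have hx' : x' ∈ ({2, 5, 8, 14, 17, 20, 23, 26, 29, 32} : Finset (ZMod 33)) := hmem' x' (by simp)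
  have hy' : y' ∈ ({2, 5, 8, 14, 17, 20, 23, 26, 29, 32} : Finset (ZMod 33)) := hmem' y' (by simp)
  obtain ⟨t₀, ht₀, hne⟩ := enum11 y hy x' hx' y' hy'
  subst hz hz'
  have hshape : ((11 : ZMod 33) ::ₘ ({y, -(11 + y)} : Multiset (ZMod 33))) + {x', y', -(x' + y')} =
      (11 : ZMod 33) ::ₘ y ::ₘ (-(11 + y)) ::ₘ x' ::ₘ y' ::ₘ {-(x' + y')} := by
    simp only [insert_eq_cons, cons_add, singleton_add]
  rw [hshape]
  exact not_isHodgeMultiset_of_witness ht₀ hne (by simp)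

/-- **`semi` closure at level 33**: every Hodge semi-decomposable sextuple of `ℤ/33` (Shioda's type-II
supply) has an even number of multiples of `11`. [cite: Shioda1979PJA, §1 Definition (iii)] -/
theorem even_countP_of_isSemiDecomposable {s : Multiset (ZMod 33)} (hs : IsHodgeMultiset s)
    (hsemi : IsSemiDecomposable s) : Even (s.countP (· ∈ ({11, 22} : Finset (ZMod 33)))) := by
  by_contra hodd
  obtain ⟨t, u, ht, hu, ht0, hu0, rfl⟩ := hsemi
  have h6 : card (t + u) = 6 := by rw [card_add, ht, hu]
  rcases shape_of_card_six hs h6 hodd with ⟨h22, h11, hU1⟩ | ⟨h11, h22, hU2⟩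
  · have hmem : ∀ a ∈ t + u, a ∈ ({1, 4, 7, 10, 13, 16, 19, 25, 28, 31} : Finset (ZMod 33)) ∨ a = 22 := by
      have hcnt : (t + u).countP (· ∈ ({1, 4, 7, 10, 13, 16, 19, 25, 28, 31} : Finset (ZMod 33))
            ∪ ({22} : Finset (ZMod 33))) = card (t + u) := by
        apply le_antisymm (countP_le_card _ _)
        rw [h6, countP_mem_eq_sum_count, Finset.sum_union (by decide : Disjoint ({1, 4, 7, 10, 13, 16, 19, 25, 28,
              31} : Finset (ZMod 33)) {22}),
          Finset.sum_singleton, ← countP_mem_eq_sum_count, hU1, h22]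
      intro a ha
      have := (countP_eq_card.1 hcnt) a ha
      exact (Finset.mem_union.1 this).imp_right Finset.mem_singleton.1
    have h22mem : (22 : ZMod 33) ∈ t + u := count_pos.1 (by rw [h22]; exact one_pos)
    rcases Multiset.mem_add.1 h22mem with h | h
    · exact semi_core22 ht hu ht0 hu0 hmem h22 h hs
    · rw [add_comm] at hs hmem h22
      exact semi_core22 hu ht hu0 ht0 hmem h22 h hs
  · have hmem : ∀ a ∈ t + u, a ∈ ({2, 5, 8, 14, 17, 20, 23, 26, 29, 32} : Finset (ZMod 33)) ∨ a = 11 := by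
      have hcnt : (t + u).countP (· ∈ ({2, 5, 8, 14, 17, 20, 23, 26, 29, 32} : Finset (ZMod 33))
            ∪ ({11} : Finset (ZMod 33))) = card (t + u) := by
        apply le_antisymm (countP_le_card _ _)
        rw [h6, countP_mem_eq_sum_count, Finset.sum_union (by decide : Disjoint ({2, 5, 8, 14, 17, 20, 23, 26, 29,
              32} : Finset (ZMod 33)) {11}),
          Finset.sum_singleton, ← countP_mem_eq_sum_count, hU2, h11]
      intro a ha
      have := (countP_eq_card.1 hcnt) a ha
      exact (Finset.mem_union.1 this).imp_right Finset.mem_singleton.1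
    have h11mem : (11 : ZMod 33) ∈ t + u := count_pos.1 (by rw [h11]; exact one_pos)
    rcases Multiset.mem_add.1 h11mem with h | h
    · exact semi_core11 ht hu ht0 hu0 hmem h11 h hs
    · rw [add_comm] at hs hmem h11
      exact semi_core11 hu ht hu0 ht0 hmem h11 h hs

/-- The odd prime divisors `p` of `33` with `33/p > 2` are `3` and `11`. [folklore] -/
theorem prime_dvd_33 {p : ℕ} (hp : p.Prime) (hpd : p ∣ 33) (hlt : 2 < 33 / p) : p = 3 ∨ p = 11 := by
  have hmem : p ∈ Nat.divisors 33 := Nat.mem_divisors.2 ⟨hpd, by norm_num⟩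
  rw [show Nat.divisors 33 = {1, 3, 11, 33} from by decide] at hmem
  simp only [Finset.mem_insert, Finset.mem_singleton] at hmem
  rcases hmem with rfl | rfl | rfl | rfl
  · exact absurd hp Nat.not_prime_one
  · exact Or.inl rfl
  · exact Or.inr rfl
  · norm_num at hlt

/-- Aoki's `3`-standard elements `σ_{3,a} = {a, a+11, a+22, -3a}`, `(a, 11) = 1`, have an even number of
multiples of `11` (namely none). [cite: Aoki1987, §1 p. 387 (σ_{p,i}) and Thm. 2-1] -/
theorem even_countP_standard3 : ∀ a : ZMod 33, Nat.Coprime a.val (33 / 3) →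
    Even (Multiset.countP (· ∈ ({11, 22} : Finset (ZMod 33))) ((Multiset.range 3).map
      (fun k : ℕ ↦ a + (k : ZMod 33) * ((33 / 3 : ℕ) : ZMod 33)) + {-(((3 : ℕ) : ZMod 33) * a)})) := by
  decide +kernel

/-- Aoki's `11`-standard elements `σ_{11,a} = {a, a+3, …, a+30, -11a}`, `(a, 3) = 1`, have an even number
of multiples of `11` (namely two). [cite: Aoki1987, §1 p. 387 (σ_{p,i}) and Thm. 2-1] -/
theorem even_countP_standard11 : ∀ a : ZMod 33, Nat.Coprime a.val (33 / 11) →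
    Even (Multiset.countP (· ∈ ({11, 22} : Finset (ZMod 33))) ((Multiset.range 11).map
      (fun k : ℕ ↦ a + (k : ZMod 33) * ((33 / 11 : ℕ) : ZMod 33)) + {-(((11 : ℕ) : ZMod 33) * a)})) := by
  decide +kernel

/-- **The parity family is closed under Shioda's inductive structure** (the tree's `IsShiodaClosed`:
pairs, Lefschetz `(1,1)` surface classes, semi-decomposable sextuples, type II `star`, type I `hash`).
[cite: Shioda1979PJA, §4 (the isomorphism (*) "which preserves algebraic cycles")] -/
theorem isShiodaClosed_parity33 :
    IsShiodaClosed (fun s : Multiset (ZMod 33) ↦ Even (s.countP (· ∈ ({11, 22} : Finset (ZMod 33))))) where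
  pair a _ := by
    show Even (Multiset.countP _ _)
    rw [insert_eq_cons, ← cons_zero, countP_cons, countP_cons, countP_zero, Nat.even_iff]
    simp only [S33_symm a]
    split_ifs <;> decide
  surface _ hs h4 := even_countP_of_card_four hs h4
  semi _ hs hsemi := even_countP_of_isSemiDecomposable hs hsemi
  star t u _ _ _ _ ht hu := by
    show Even (Multiset.countP _ _)
    rw [countP_add]; exact ht.add hu
  hash e t u _ _ _ _ _ ht hu := by
    simp only [countP_cons, countP_add, Nat.even_iff] at *
    simp only [S33_symm e] at hu
    split_ifs at ht hu <;> omega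

/-- **LEVEL-33 INSUFFICIENCY OF THE PRINTED CLAIM CALCULUS.** There is a family `C` of multisets of
`ℤ/33` which is closed under Shioda's inductive structure (`IsShiodaClosed`: pairs — Aoki 1987 Thm. 1-1 —,
every Hodge 4-multiset — Lefschetz `(1,1)` on `X²₃₃` —, every Hodge semi-decomposable sextuple, type II
juxtaposition, type I), under the multiset shadows of the tree's named facts `Shioda_claim_paired`
(every paired character), `Aoki1987_claim_juxtaposition` (Thm. 1-4 (i)), `Aoki1987_claim_of_claim_juxtaposition_paired`
(Thm. 1-4 (ii), pair cancellation), `Aoki1987_claim_pStandard` (Thm. 2-1: every standard element `σ_{p,a}`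
of level `33`, `p ∈ {3, 11}`, `(a, 33/p) = 1`), and under GENERAL cancellation (card
`cancel-by-any-claim-lattice`), and which does NOT contain da Silva's Hodge character `(1,4,16,25,31,22)` of
`X⁴₃₃`. Hence no argument using only this supply AT LEVEL `33` proves claim of that character (da Silva's
"`(P₃₃)` is false" is the one-step case); the level must change (the crux team's level-`66` certificate)
or a new cycle must enter. `C s :=` "the number of entries of `s` divisible by `11` is even".
[cite: daSilva2021HodgeFermat, Prop. 3.4 (version of record) = arXiv:2101.04739 Prop. 3.6]
[cite: Aoki1987, Thm. 1-1, Thm. 1-4 (i),(ii), Thm. 2-1] -/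
theorem exists_closed_family_not_daSilva33 :
    ∃ C : Multiset (ZMod 33) → Prop,
      IsShiodaClosed C ∧
      (∀ (t : ℕ) (δ : Fin (2 * t + 2) → ZMod 33), (∀ i, δ i ≠ 0) → IsPaired δ → C (univ.val.map δ)) ∧
      (∀ s t : Multiset (ZMod 33), IsHodgeMultiset s → IsHodgeMultiset t → C s → C t → C (s + t)) ∧
      (∀ (s : Multiset (ZMod 33)) (t : ℕ) (δ : Fin (2 * t + 2) → ZMod 33), IsHodgeMultiset s →
        (∀ i, δ i ≠ 0) → IsPaired δ → C (s + univ.val.map δ) → C s) ∧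
      (∀ p r : ℕ, p.Prime → p = 2 * r + 1 → p ∣ 33 → 2 < 33 / p →
        ∀ a : ZMod 33, Nat.Coprime a.val (33 / p) →
          C ((Multiset.range p).map (fun k : ℕ ↦ a + (k : ZMod 33) * ((33 / p : ℕ) : ZMod 33)) +
            {-((p : ZMod 33) * a)})) ∧
      (∀ s t : Multiset (ZMod 33), IsHodgeMultiset s → IsHodgeMultiset t → C t → C (s + t) → C s) ∧
      IsHodgeMultiset ({1, 4, 16, 25, 31, 22} : Multiset (ZMod 33)) ∧ ¬ C ({1, 4, 16, 25, 31,
            22} : Multiset (ZMod 33)) := by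
  refine ⟨fun s ↦ Even (s.countP (· ∈ ({11, 22} : Finset (ZMod 33)))), isShiodaClosed_parity33, ?_, ?_, ?_, ?_, ?_,
    isHodgeMultiset_daSilva33, not_even_countP_daSilva33⟩
  · intro t δ _ hδ
    exact even_countP_mem_of_isPaired S33_symm hδ
  · intro s t _ _ hs ht
    show Even (Multiset.countP _ _)
    rw [countP_add]; exact hs.add ht
  · intro s t δ _ _ hδ h
    have h' : Even ((s + univ.val.map δ).countP (· ∈ ({11, 22} : Finset (ZMod 33)))) := h
    rw [countP_add] at h'
    exact (Nat.even_add.1 h').2 (even_countP_mem_of_isPaired S33_symm hδ)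
  · intro p r hp hpr hpd hlt a ha
    rcases prime_dvd_33 hp hpd hlt with rfl | rfl
    · exact even_countP_standard3 a ha
    · exact even_countP_standard11 a ha
  · intro s t _ _ ht hst
    have h' : Even ((s + t).countP (· ∈ ({11, 22} : Finset (ZMod 33)))) := hst
    rw [countP_add] at h'
    exact (Nat.even_add.1 h').2 ht

/-- Equivalently: "every such closed family contains da Silva's class" is FALSE at level `33`.
[cite: daSilva2021HodgeFermat, Prop. 3.4 (version of record)] -/
theorem not_forall_closed_family_daSilva33 :
    ¬ ∀ C : Multiset (ZMod 33) → Prop, IsShiodaClosed C →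
      (∀ (t : ℕ) (δ : Fin (2 * t + 2) → ZMod 33), (∀ i, δ i ≠ 0) → IsPaired δ → C (univ.val.map δ)) →
      (∀ (s : Multiset (ZMod 33)) (t : ℕ) (δ : Fin (2 * t + 2) → ZMod 33), IsHodgeMultiset s →
        (∀ i, δ i ≠ 0) → IsPaired δ → C (s + univ.val.map δ) → C s) →
      (∀ p r : ℕ, p.Prime → p = 2 * r + 1 → p ∣ 33 → 2 < 33 / p →
        ∀ a : ZMod 33, Nat.Coprime a.val (33 / p) →
          C ((Multiset.range p).map (fun k : ℕ ↦ a + (k : ZMod 33) * ((33 / p : ℕ) : ZMod 33)) +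
            {-((p : ZMod 33) * a)})) →
      (∀ s t : Multiset (ZMod 33), IsHodgeMultiset s → IsHodgeMultiset t → C t → C (s + t) → C s) →
      C ({1, 4, 16, 25, 31, 22} : Multiset (ZMod 33)) := by
  intro h
  obtain ⟨C, hS, hpaired, _, hcancel, hstd, hany, _, hnot⟩ := exists_closed_family_not_daSilva33
  exact hnot (h C hS hpaired hcancel hstd hany)

end Summit.HodgeConjecture.HodgeConjecture.Theorems.HodgeFermatVarietiesNegative
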